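import Mathlib
import Summits.Ventures.PercRepro2.Defs
import Summits.Ventures.PercRepro2.Graph
import Summits.Ventures.PercRepro2.OneColourSwitch
import Summits.Ventures.PercRepro2.RegionHubSign
import Summits.Ventures.PercRepro2.SideSwitch
import Summits.Ventures.PercRepro2.SideSwitchFibre
import Summits.Ventures.PercRepro2.SideSwitchClosed
import Summits.Ventures.PercRepro2.SideSwitchComps
import Summits.Ventures.PercRepro2.M9NoPocketDefs
import Summits.Ventures.PercRepro2.M9NoPocketWorld
import Summits.Ventures.PercRepro2.M9NoPocketWorldD
import Summits.Ventures.PercRepro2.M9NoPocketLegal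
import Summits.Ventures.PercRepro2.M9NoPocketCompl
import Summits.Ventures.PercRepro2.M9PsiOneDefs
import Summits.Ventures.PercRepro2.M9NoPocketFreeBlock
import Summits.Ventures.PercRepro2.M9NoPocketFreeBlockK
import Summits.Ventures.PercRepro2.M9NoPocketSameType
import Summits.Ventures.PercRepro2.M9NoPocketDeadPattern
import Summits.Ventures.PercRepro2.M9NoPocketLinkCompl
import Summits.Ventures.PercRepro2.M9NoPocketLinkE
import Summits.Ventures.PercRepro2.M9NoPocketSigmaRS
import Summits.Ventures.PercRepro2.M9NoPocketUnitK
import Summits.Ventures.PercRepro2.M9QuadHarrisPow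
import Summits.Ventures.PercRepro2.M9NoPocketGoodEdge

/-!
# Good edges: the converse, every edge is good for a root, and the count of the linking
patterns (blind cell PercRepro2, p3 g36, 2026-08-29; `proofs/P3-NPHDR.md` §5′(c′))

Two live good edges into unswitched blocks, one for each root, give the `Y`-link of the point
(`conn_of_good`); every edge of `d` is good for some root (`good_of_edge`).  Hence, when no
joined block links internally, a linking proper joined `Y`-side set `S` yields two distinct
linking dead patterns: with `e_r, e_s` the good edges into `S` and `e₃` an edge into a block
outside `S`, the patterns `{e₃}` and `{e_r}` or `{e_s}` (whichever root `e₃` is good for) both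
keep a good edge for each root (`two_le_sum_linkK_of_no_internal_link`); when some joined block
links internally every pattern links (`two_le_sum_linkK_of_internal_link`).  Together: **the
counting hypothesis of the 2EXHD quad inequality** (`two_le_sum_linkK`).  Own work; std axioms.
-/

namespace Summit.Ventures.PercRepro2

namespace NoPocket

open Finset Classical RegionHub OneColourSwitch SideSwitch M9Reduce

variable {V : Type*} {E : Type*}

section GoodCount

variable [Fintype V] [DecidableEq V] [Fintype E] [DecidableEq E] {ends : E → Sym2 V}

/-- **Two live good edges give the link.** -/
theorem conn_of_good {p q r s d : V} (hr : d ≠ r) (hs : d ≠ s) (hT : Tset ends d r s = ∅)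
    {ρ₀ : Config E} (hρ₀ : ρ₀ ∈ RepD ends p q r s d) (hst : ∀ e, d ∈ ends e → ρ₀ e = true)
    {D : Finset E} (hD : ∀ e ∈ D, d ∈ ends e) {X : Finset (Finset V)}
    (hX : X ⊆ blocks ends d r s ρ₀)
    (hgr : ∃ e, e ∉ D ∧ ∃ C ∈ blocks ends d r s ρ₀, C ∉ X ∧ ∃ y ∈ C, ends e = s(d, y) ∧
      Conn ends (restrictTo ends ρ₀ (↑C ∪ {r})) r y)
    (hgs : ∃ e, e ∉ D ∧ ∃ C ∈ blocks ends d r s ρ₀, C ∉ X ∧ ∃ y ∈ C, ends e = s(d, y) ∧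
      Conn ends (restrictTo ends ρ₀ (↑C ∪ {s})) s y) :
    Conn ends (assignX ends (X, ∅) (flipF D ρ₀)) r s := by
  obtain ⟨er, herD, Cr, hCr, hCrX, yr, hyr, hendsr, hconnr⟩ := hgr
  obtain ⟨es, hesD, Cs, hCs, hCsX, ys, hys, hendss, hconns⟩ := hgs
  -- the restrictions lie below the point
  have hle : ∀ (a : V), a = r ∨ a = s → ∀ C ∈ blocks ends d r s ρ₀, C ∉ X →
      restrictTo ends ρ₀ (↑C ∪ {a}) ≤ assignX ends (X, ∅) (flipF D ρ₀) := by
    intro a ha C hC hCX e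
    unfold restrictTo
    by_cases he : e ∈ within ends (↑C ∪ {a} : Set V)
    · rw [if_pos he, assignX_flipF_eq_of_within hρ₀ hr hs hT hD hX hC hCX ha he]
    · rw [if_neg he]
      exact Bool.false_le _
  -- the live edges are open at the point
  have hopen : ∀ e, e ∉ D → ∀ C ∈ blocks ends d r s ρ₀, C ∉ X → ∀ y ∈ C, ends e = s(d, y) →
      assignX ends (X, ∅) (flipF D ρ₀) e = true := by
    intro e heD C hC hCX y hy hends
    rw [assignX_flipF_at_d hr hs hX hC hCX hy hends, flipF_of_notMem heD]
    exact hst e (by rw [hends]; exact Sym2.mem_mk_left _ _)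
  have h1 : Conn ends (assignX ends (X, ∅) (flipF D ρ₀)) r yr :=
    conn_mono (hle r (Or.inl rfl) Cr hCr hCrX) hconnr
  have h2 : Conn ends (assignX ends (X, ∅) (flipF D ρ₀)) yr d :=
    conn_of_openAdj ⟨er, hopen er herD Cr hCr hCrX yr hyr hendsr, by rw [hendsr, Sym2.eq_swap]⟩
  have h3 : Conn ends (assignX ends (X, ∅) (flipF D ρ₀)) d ys :=
    conn_of_openAdj ⟨es, hopen es hesD Cs hCs hCsX ys hys hendss, hendss⟩
  have h4 : Conn ends (assignX ends (X, ∅) (flipF D ρ₀)) ys s :=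
    conn_symm (conn_mono (hle s (Or.inr rfl) Cs hCs hCsX) hconns)
  exact conn_trans (conn_trans (conn_trans h1 h2) h3) h4

/-- **Every block vertex is reached by a root inside its block**: `r` inside `C ∪ {r}` or `s`
inside `C ∪ {s}`. -/
theorem good_of_block_vertex {p q r s d : V} (hr : d ≠ r) (hs : d ≠ s) (hrs : ∀ e, ends e ≠ s(r, s))
    {ρ₀ : Config E} (hρ₀ : ρ₀ ∈ RepD ends p q r s d) {C : Finset V}
    (hC : C ∈ blocks ends d r s ρ₀) {y : V} (hy : y ∈ C) :
    Conn ends (restrictTo ends ρ₀ (↑C ∪ {r})) r y ∨ Conn ends (restrictTo ends ρ₀ (↑C ∪ {s})) s y := by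
  have hyK : y ∈ K2 (endsD ends d) r s ρ₀ := mem_K2_endsD_of_block hρ₀ hC hy
  -- the closure set in `G − d`
  have key : ∀ (a : V), a = r ∨ a = s → Conn (endsD ends d) ρ₀ a y →
      y ∈ {z | z ∈ K2 (endsD ends d) r s ρ₀ ∧ (z = r ∨ z = s ∨ ∃ C' ∈ blocks ends d r s ρ₀,
        z ∈ C' ∧ (Conn ends (restrictTo ends ρ₀ (↑C' ∪ {r})) r z ∨
          Conn ends (restrictTo ends ρ₀ (↑C' ∪ {s})) s z))} := by
    intro a ha hc
    have haK : a ∈ K2 (endsD ends d) r s ρ₀ := by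
      rcases ha with ha | ha
      · rw [ha]; exact r_mem_K2 r s ρ₀
      · rw [ha]; exact s_mem_K2 r s ρ₀
    have ha' : a = r ∨ a = s ∨ ∃ C' ∈ blocks ends d r s ρ₀, a ∈ C' ∧
        (Conn ends (restrictTo ends ρ₀ (↑C' ∪ {r})) r a ∨
          Conn ends (restrictTo ends ρ₀ (↑C' ∪ {s})) s a) := by
      rcases ha with ha | ha
      · exact Or.inl ha
      · exact Or.inr (Or.inl ha)
    refine mem_of_conn_of_closed (ends := endsD ends d) (ω := ρ₀) ?_ ⟨haK, ha'⟩ hc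
    rintro z ⟨hzK, hz⟩ v hadj
    obtain ⟨hzv, hzd, hvd, e, he, hends⟩ := openGraph_endsD_adj.1 hadj
    have hvK : v ∈ K2 (endsD ends d) r s ρ₀ :=
      mem_K2_of_open hzK he (by rw [endsD_of_notMem (notMem_of_ends_ne hends hzd hvd)]; exact hends)
    refine ⟨hvK, ?_⟩
    -- the root cases: an open edge from a root into a block starts a restricted connection
    have hroot : ∀ (a : V), a = r ∨ a = s → z = a → v = r ∨ v = s ∨ ∃ C' ∈ blocks ends d r s ρ₀,
        v ∈ C' ∧ (Conn ends (restrictTo ends ρ₀ (↑C' ∪ {r})) r v ∨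
          Conn ends (restrictTo ends ρ₀ (↑C' ∪ {s})) s v) := by
      intro a ha hza
      rw [hza] at hends
      rcases mem_A0_of_mem_K2_endsD hvK with hvr | hvs | hvA
      · exact Or.inl hvr
      · exact Or.inr (Or.inl hvs)
      · obtain ⟨hC', hvC'⟩ := block_of_mem_A0 (ends := ends) (r := r) (s := s) (ρ := ρ₀) hvA
        refine Or.inr (Or.inr ⟨_, hC', hvC', ?_⟩)
        have hconn : Conn ends (restrictTo ends ρ₀ (↑(compIn (endsD ends d)
            (↑(A0 (endsD ends d) r s ρ₀) : Set V) v) ∪ {a})) a v := by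
          refine conn_of_openAdj ⟨e, ?_, hends⟩
          unfold restrictTo
          rw [if_pos ⟨a, Or.inr rfl, v, Or.inl (Finset.mem_coe.2 hvC'), hends⟩]
          exact he
        rcases ha with rfl | rfl
        · exact Or.inl hconn
        · exact Or.inr hconn
    rcases hz with hzr | hzs | ⟨C', hC', hzC', hz⟩
    · exact hroot r (Or.inl rfl) hzr
    · exact hroot s (Or.inr rfl) hzs
    · by_cases hvC' : v ∈ C'
      · refine Or.inr (Or.inr ⟨C', hC', hvC', ?_⟩)
        have hstep : ∀ (a : V), Conn ends (restrictTo ends ρ₀ (↑C' ∪ {a})) a z →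
            Conn ends (restrictTo ends ρ₀ (↑C' ∪ {a})) a v := by
          intro a h
          refine conn_trans h (conn_of_openAdj ⟨e, ?_, hends⟩)
          unfold restrictTo
          rw [if_pos ⟨z, Or.inl (Finset.mem_coe.2 hzC'), v, Or.inl (Finset.mem_coe.2 hvC'), hends⟩]
          exact he
        rcases hz with hz | hz
        · exact Or.inl (hstep r hz)
        · exact Or.inr (hstep s hz)
      · rcases mem_A0_of_mem_K2_endsD hvK with hvr | hvs | hvA
        · exact Or.inl hvr
        · exact Or.inr (Or.inl hvs)
        · exfalso
          obtain ⟨hC'', hvC''⟩ := block_of_mem_A0 (ends := ends) (r := r) (s := s) (ρ := ρ₀) hvA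
          exact hvC' (mem_block_of_edge hC' hC'' hzC' hvC'' hends hzd hvd)
  have hyK' : Conn (endsD ends d) ρ₀ r y ∨ Conn (endsD ends d) ρ₀ s y := mem_K2_iff.1 hyK
  have hmem : y ∈ {z | z ∈ K2 (endsD ends d) r s ρ₀ ∧ (z = r ∨ z = s ∨ ∃ C' ∈ blocks ends d r s ρ₀,
      z ∈ C' ∧ (Conn ends (restrictTo ends ρ₀ (↑C' ∪ {r})) r z ∨
        Conn ends (restrictTo ends ρ₀ (↑C' ∪ {s})) s z))} := by
    rcases hyK' with h | h
    · exact key r (Or.inl rfl) h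
    · exact key s (Or.inr rfl) h
  obtain ⟨_, hyr | hys | ⟨C', hC', hyC', hgood⟩⟩ := hmem
  · exact absurd (hyr ▸ hy) (r_notMem_block hρ₀ hC).1
  · exact absurd (hys ▸ hy) (r_notMem_block hρ₀ hC).2
  · rw [blocks_eq_of_shared_vertex hC hC' hy hyC']
    exact hgood

omit [Fintype V] in
/-- A singleton pattern `{e}` of an edge at `d` is a proper non-empty pattern when another edge
at `d` exists. -/
lemma singleton_mem_patterns {d : V} {e e' : E} (he : d ∈ ends e) (he' : d ∈ ends e') (hne : e ≠ e') :
    ({e} : Finset E) ∈ (univ.filter (fun e => d ∈ ends e)).powerset.filter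
      (fun D => D ≠ ∅ ∧ D ≠ univ.filter (fun e => d ∈ ends e)) := by
  refine Finset.mem_filter.2 ⟨Finset.mem_powerset.2 ?_, Finset.singleton_ne_empty e, ?_⟩
  · intro x hx
    rw [Finset.mem_singleton] at hx
    rw [hx]
    exact Finset.mem_filter.2 ⟨Finset.mem_univ _, he⟩
  · intro h
    have : e' ∈ ({e} : Finset E) := by
      rw [h]; exact Finset.mem_filter.2 ⟨Finset.mem_univ _, he'⟩
    exact hne (Finset.mem_singleton.1 this).symm

omit [Fintype V] [DecidableEq V] [Fintype E] [DecidableEq E] in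
/-- Two edges of `d` with the same other end are equal as edges of `d` only if their other ends
agree (no loop at `d`). -/
lemma other_end_eq {d y y' : V} (hloop : ∀ e, ends e ≠ s(d, d)) {e : E} (h : ends e = s(d, y))
    (h' : ends e = s(d, y')) : y = y' := by
  rw [h, Sym2.eq_iff] at h'
  rcases h' with ⟨_, h'⟩ | ⟨hd, hy⟩
  · exact h'
  · exfalso
    rw [hy] at h
    exact hloop e h

/-- Two distinct linking patterns give `Σ ℓK ≥ 2`. -/
lemma two_le_sum_of_two {d r s : V} {ρ₀ : Config E} {𝔉 : Finset (Finset V)} {D₁ D₂ : Finset E}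
    (h₁ : D₁ ∈ (univ.filter (fun e => d ∈ ends e)).powerset.filter
      (fun D => D ≠ ∅ ∧ D ≠ univ.filter (fun e => d ∈ ends e)))
    (h₂ : D₂ ∈ (univ.filter (fun e => d ∈ ends e)).powerset.filter
      (fun D => D ≠ ∅ ∧ D ≠ univ.filter (fun e => d ∈ ends e)))
    (hne : D₁ ≠ D₂) (hc₁ : Conn ends (assignX ends (𝔉, ∅) (flipF D₁ ρ₀)) r s)
    (hc₂ : Conn ends (assignX ends (𝔉, ∅) (flipF D₂ ρ₀)) r s) :
    2 ≤ ∑ D ∈ (univ.filter (fun e => d ∈ ends e)).powerset.filter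
        (fun D => D ≠ ∅ ∧ D ≠ univ.filter (fun e => d ∈ ends e)),
      (if Conn ends (assignX ends (𝔉, ∅) (flipF D ρ₀)) r s then (1 : ℤ) else 0) := by
  have hsub : ({D₁, D₂} : Finset (Finset E)) ⊆ (univ.filter (fun e => d ∈ ends e)).powerset.filter
      (fun D => D ≠ ∅ ∧ D ≠ univ.filter (fun e => d ∈ ends e)) := by
    intro D hD
    rcases Finset.mem_insert.1 hD with rfl | hD
    · exact h₁
    · rw [Finset.mem_singleton] at hD
      rw [hD]; exact h₂
  refine le_trans ?_ (Finset.sum_le_sum_of_subset_of_nonneg hsub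
    (fun D _ _ => by split_ifs <;> norm_num))
  rw [Finset.sum_pair hne, if_pos hc₁, if_pos hc₂]
  norm_num

/-- **The counting hypothesis of the 2EXHD quad inequality**: a linking proper joined `Y`-side
set yields at least two linking dead patterns. -/
theorem two_le_sum_linkK {p q r s d : V} (hnp : NoPocketAt ends d r s) (hr : d ≠ r) (hs : d ≠ s)
    (hT : Tset ends d r s = ∅) (hloop : ∀ e, ends e ≠ s(d, d)) (hrs : ∀ e, ends e ≠ s(r, s))
    (hrs' : r ≠ s) {ρ₀ : Config E} (hρ₀ : ρ₀ ∈ RepD ends p q r s d)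
    (hst : ∀ e, d ∈ ends e → ρ₀ e = true) {𝔉 𝔑 : Finset (Finset V)}
    (h𝔉 : 𝔉 = (blocks ends d r s ρ₀).filter (fun C => ¬ hasY ends d ρ₀ C))
    (h𝔑 : 𝔑 = (blocks ends d r s ρ₀).filter (hasY ends d ρ₀))
    (hS : ∃ S ∈ 𝔑.powerset.filter (fun S => S ≠ ∅ ∧ S ≠ 𝔑),
      (if Conn ends (assignX ends (𝔉 ∪ (𝔑 \ S), ∅) ρ₀) r s then (1 : ℤ) else 0) ≠ 0) :
    2 ≤ ∑ D ∈ (univ.filter (fun e => d ∈ ends e)).powerset.filter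
        (fun D => D ≠ ∅ ∧ D ≠ univ.filter (fun e => d ∈ ends e)),
      (if Conn ends (assignX ends (𝔉, ∅) (flipF D ρ₀)) r s then (1 : ℤ) else 0) := by
  obtain ⟨S, hSp, hℓS⟩ := hS
  obtain ⟨hSn, hS0, hSN⟩ := mem_properOf.1 hSp
  have hc : Conn ends (assignX ends (𝔉 ∪ (𝔑 \ S), ∅) ρ₀) r s := by
    by_contra h
    exact hℓS (if_neg h)
  -- the joined blocks are joined: an edge of `d` into each
  have hedge : ∀ C ∈ 𝔑, ∃ e, d ∈ ends e ∧ ∃ y ∈ C, ends e = s(d, y) := by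
    intro C hC
    rw [h𝔑] at hC
    obtain ⟨e, y, hy, hends⟩ := (hasY_sameType_iff hst C).1 (Finset.mem_filter.1 hC).2
    exact ⟨e, by rw [hends]; exact Sym2.mem_mk_left _ _, y, hy, hends⟩
  have h𝔑b : 𝔑 ⊆ blocks ends d r s ρ₀ := by rw [h𝔑]; exact Finset.filter_subset _ _
  have h𝔉b : 𝔉 ⊆ blocks ends d r s ρ₀ := by rw [h𝔉]; exact Finset.filter_subset _ _
  have hjoined : ∀ C ∈ 𝔑, C ∉ 𝔉 := by
    intro C hC hCf
    rw [h𝔑] at hC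
    rw [h𝔉] at hCf
    exact (Finset.mem_filter.1 hCf).2 (Finset.mem_filter.1 hC).2
  -- a block outside `S` and one inside
  obtain ⟨C₃, hC₃N, hC₃S⟩ := Finset.exists_of_ssubset (Finset.ssubset_iff_subset_ne.2 ⟨hSn, hSN⟩)
  obtain ⟨e₃, he₃d, y₃, hy₃, hends₃⟩ := hedge C₃ hC₃N
  -- edges landing in different blocks are different
  have hdiff : ∀ {e e' : E} {C C' : Finset V}, C ∈ blocks ends d r s ρ₀ →
      C' ∈ blocks ends d r s ρ₀ → ∀ {y y' : V}, y ∈ C → y' ∈ C' → ends e = s(d, y) →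
      ends e' = s(d, y') → C ≠ C' → e ≠ e' := by
    intro e e' C C' hC hC' y y' hy hy' hends hends' hCC' hee'
    rw [hee'] at hends
    have := other_end_eq hloop hends hends'
    rw [this] at hy
    exact hCC' (blocks_eq_of_shared_vertex hC hC' hy hy')
  by_cases hlink : ∃ C ∈ 𝔑, LinksIn ends ρ₀ r s C
  · -- some joined block links internally: every pattern links
    obtain ⟨C, hCN, hCL⟩ := hlink
    obtain ⟨C₁, hC₁S⟩ := Finset.nonempty_iff_ne_empty.2 hS0
    obtain ⟨e₁, he₁d, y₁, hy₁, hends₁⟩ := hedge C₁ (hSn hC₁S)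
    have hne : e₁ ≠ e₃ := hdiff (h𝔑b (hSn hC₁S)) (h𝔑b hC₃N) hy₁ hy₃ hends₁ hends₃
      (fun h => hC₃S (h ▸ hC₁S))
    have hlinkD : ∀ D : Finset E, (∀ e ∈ D, d ∈ ends e) →
        Conn ends (assignX ends (𝔉, ∅) (flipF D ρ₀)) r s := by
      intro D hD
      have hρD := flipF_mem_RepD hρ₀ hT hD
      have hb := blocks_flipF (ends := ends) (r := r) (s := s) (ρ := ρ₀) hD
      refine conn_rs_of_linksIn hρD hr hs (x := (𝔉, ∅)) (by rw [hb]; exact h𝔉b) rfl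
        (by rw [hb]; exact h𝔑b hCN) (hjoined C hCN) ?_
      rw [linksIn_flipF_iff hr hs hD (h𝔑b hCN)]
      exact hCL
    refine two_le_sum_of_two (singleton_mem_patterns he₁d he₃d hne)
      (singleton_mem_patterns he₃d he₁d hne.symm) ?_ (hlinkD _ ?_) (hlinkD _ ?_)
    · intro h
      exact hne (Finset.singleton_inj.1 h)
    · intro e he; rw [Finset.mem_singleton] at he; rw [he]; exact he₁d
    · intro e he; rw [Finset.mem_singleton] at he; rw [he]; exact he₃d
  · -- no joined block links internally: good edges
    have hnl : ∀ C ∈ blocks ends d r s ρ₀, hasY ends d ρ₀ C → ¬ LinksIn ends ρ₀ r s C := by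
      intro C hC hY hL
      exact hlink ⟨C, by rw [h𝔑]; exact Finset.mem_filter.2 ⟨hC, hY⟩, hL⟩
    have hX : 𝔉 ∪ (𝔑 \ S) ⊆ blocks ends d r s ρ₀ :=
      Finset.union_subset h𝔉b (Finset.sdiff_subset.trans h𝔑b)
    have hXf : (blocks ends d r s ρ₀).filter (fun C => ¬ hasY ends d ρ₀ C) ⊆ 𝔉 ∪ (𝔑 \ S) := by
      rw [← h𝔉]; exact Finset.subset_union_left
    have hx : ((𝔉 ∪ (𝔑 \ S), ∅) : Finset (Finset V) × Finset E) ∈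
        L4 ends d r s (flipF ∅ ρ₀) := by
      rw [flipF_empty]
      exact (mem_L4_sameType_iff hT hst).2 ⟨hX, rfl⟩
    have hc' : Conn ends (assignX ends (𝔉 ∪ (𝔑 \ S), ∅) (flipF ∅ ρ₀)) r s := by
      rw [flipF_empty]; exact hc
    have h0 : ∀ e ∈ (∅ : Finset E), d ∈ ends e := fun e he => absurd he (Finset.notMem_empty e)
    obtain ⟨er, _, Cr, hCr, hCrX, yr, hyr, hendsr, hgr⟩ :=
      exists_good_of_conn hnp hr hs hT hrs hrs' hρ₀ hst hnl h0 hX hXf hx (Or.inl ⟨rfl, rfl⟩) hc'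
    obtain ⟨es, _, Cs, hCs, hCsX, ys, hys, hendss, hgs⟩ :=
      exists_good_of_conn hnp hr hs hT hrs hrs' hρ₀ hst hnl h0 hX hXf hx (Or.inr ⟨rfl, rfl⟩)
        (conn_symm hc')
    -- the blocks of the good edges lie in `S`
    have hinS : ∀ {C : Finset V}, C ∈ blocks ends d r s ρ₀ → C ∉ 𝔉 ∪ (𝔑 \ S) → C ∈ S := by
      intro C hC hCX
      have hCN : C ∈ 𝔑 := by
        rw [h𝔑]
        refine Finset.mem_filter.2 ⟨hC, ?_⟩
        by_contra hY
        exact hCX (Finset.mem_union_left _ (by rw [h𝔉]; exact Finset.mem_filter.2 ⟨hC, hY⟩))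
      by_contra hCS
      exact hCX (Finset.mem_union_right _ (Finset.mem_sdiff.2 ⟨hCN, hCS⟩))
    have hCrS := hinS hCr hCrX
    have hCsS := hinS hCs hCsX
    have herd : d ∈ ends er := by rw [hendsr]; exact Sym2.mem_mk_left _ _
    have hesd : d ∈ ends es := by rw [hendss]; exact Sym2.mem_mk_left _ _
    -- an edge is not good for both roots
    have hrs_ne : er ≠ es := by
      intro h
      rw [h] at hendsr
      have hyy := other_end_eq hloop hendsr hendss
      rw [hyy] at hyr hgr
      have hCC := blocks_eq_of_shared_vertex hCr hCs hyr hys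
      rw [hCC] at hgr
      refine hnl Cs hCs ?_ ?_
      · by_contra hY
        exact hCsX (Finset.mem_union_left _ (by rw [h𝔉]; exact Finset.mem_filter.2 ⟨hCs, hY⟩))
      · unfold LinksIn
        have h1 : Conn ends (restrictTo ends ρ₀ (↑Cs ∪ {r, s})) r ys :=
          conn_mono (restrictTo_mono_set (coe_union_root_subset (Or.inl rfl) Cs)) hgr
        have h2 : Conn ends (restrictTo ends ρ₀ (↑Cs ∪ {r, s})) s ys :=
          conn_mono (restrictTo_mono_set (coe_union_root_subset (Or.inr rfl) Cs)) hgs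
        exact conn_trans h1 (conn_symm h2)
    have he₃r : e₃ ≠ er := hdiff (h𝔑b hC₃N) hCr hy₃ hyr hends₃ hendsr (fun h => hC₃S (h ▸ hCrS))
    have he₃s : e₃ ≠ es := hdiff (h𝔑b hC₃N) hCs hy₃ hys hends₃ hendss (fun h => hC₃S (h ▸ hCsS))
    have hC₃f : C₃ ∉ 𝔉 := hjoined C₃ hC₃N
    have hCrf : Cr ∉ 𝔉 := hjoined Cr (hSn hCrS)
    have hCsf : Cs ∉ 𝔉 := hjoined Cs (hSn hCsS)
    have hD3 : ∀ e ∈ ({e₃} : Finset E), d ∈ ends e := by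
      intro e he; rw [Finset.mem_singleton] at he; rw [he]; exact he₃d
    have hDr : ∀ e ∈ ({er} : Finset E), d ∈ ends e := by
      intro e he; rw [Finset.mem_singleton] at he; rw [he]; exact herd
    have hDs : ∀ e ∈ ({es} : Finset E), d ∈ ends e := by
      intro e he; rw [Finset.mem_singleton] at he; rw [he]; exact hesd
    -- the pattern `{e₃}` links
    have hc₁ : Conn ends (assignX ends (𝔉, ∅) (flipF {e₃} ρ₀)) r s :=
      conn_of_good hr hs hT hρ₀ hst hD3 h𝔉b
        ⟨er, fun h => he₃r (Finset.mem_singleton.1 h).symm, Cr, hCr, hCrf, yr, hyr, hendsr, hgr⟩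
        ⟨es, fun h => he₃s (Finset.mem_singleton.1 h).symm, Cs, hCs, hCsf, ys, hys, hendss, hgs⟩
    -- the second pattern, by the root `e₃` is good for
    rcases good_of_block_vertex hr hs hrs hρ₀ (h𝔑b hC₃N) hy₃ with hg3r | hg3s
    · have hc₂ : Conn ends (assignX ends (𝔉, ∅) (flipF {er} ρ₀)) r s :=
        conn_of_good hr hs hT hρ₀ hst hDr h𝔉b
          ⟨e₃, fun h => he₃r (Finset.mem_singleton.1 h), C₃, h𝔑b hC₃N, hC₃f, y₃, hy₃, hends₃, hg3r⟩
          ⟨es, fun h => hrs_ne (Finset.mem_singleton.1 h).symm, Cs, hCs, hCsf, ys, hys, hendss, hgs⟩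
      exact two_le_sum_of_two (singleton_mem_patterns he₃d herd he₃r)
        (singleton_mem_patterns herd he₃d he₃r.symm)
        (fun h => he₃r (Finset.singleton_inj.1 h)) hc₁ hc₂
    · have hc₂ : Conn ends (assignX ends (𝔉, ∅) (flipF {es} ρ₀)) r s :=
        conn_of_good hr hs hT hρ₀ hst hDs h𝔉b
          ⟨er, fun h => hrs_ne (Finset.mem_singleton.1 h), Cr, hCr, hCrf, yr, hyr, hendsr, hgr⟩
          ⟨e₃, fun h => he₃s (Finset.mem_singleton.1 h), C₃, h𝔑b hC₃N, hC₃f, y₃, hy₃, hends₃, hg3s⟩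
      exact two_le_sum_of_two (singleton_mem_patterns he₃d hesd he₃s)
        (singleton_mem_patterns hesd he₃d he₃s.symm)
        (fun h => he₃s (Finset.singleton_inj.1 h)) hc₁ hc₂

end GoodCount

end NoPocket

end Summit.Ventures.PercRepro2
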